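import Summits.Ventures.HodgeRepro.BallModel

/-!
# The `U(2,1)`-action on the 2-ball: action laws and the chain rule for the Jacobian (seat p5)

Blind re-derivation cell `pub-hodge-repro`, seat `p5` (second seat on statement (c), the Hecke-translate
wedge).  Built on the sealer's `BallModel.lean` (`J`, `U21`, `Ball`, `proj`, `W3`, `act`, `Jac`).

* `mkU21` — an element of `U(2,1)` from a matrix `g` with `gᴴ J g = J` (inverse `J gᴴ J`);
* `act_mul`, `act_one`, `MulAction U21 Ball` — `act` is a group action (projective linearity of `proj`:
  `proj_smul`, `lift_proj`, `W3_act`);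
* `Jac_mul` — the **chain rule** `J_{gh}(z) = J_g(hz) · J_h(z)`, an algebraic identity of the
  fractional-linear formula; hence `Jac_one`, `isUnit_Jac`, `det_Jac_ne_zero`;
* `boost a` — an explicit element `T_a ∈ U(2,1)` with `T_a · 0 = a` (`act_boost_center`): `U(2,1)` is
  transitive on the ball (`exists_act_eq`, `MulAction.IsPretransitive U21 Ball`);
* `swapU`, `phaseU` — isotropy elements at the centre (their fixed-point and Jacobian computations are
  in `BallCore.lean`).

This is the only file of the statement-(c) chain that declares definitions or instances (`mkU21`,
`center`, `sOf`, `boostP`, `kOf`, `boostMat`, `boost`, `swapMat`, `swapU`, `phaseMat`, `phaseU`, the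
`MulAction` and `IsPretransitive` instances); the wedge algebra and the core theorem of statement (c)
are in `BallCore.lean`, which is theorems only.
-/

set_option autoImplicit false

noncomputable section

namespace Summit.Ventures.HodgeRepro

namespace BallCore

open Matrix hiding J
open Complex hiding lift
open ComplexConjugate BallModel

/-! ### Elements of `U(2,1)` from matrices -/

/-- `J * J = 1`. -/
theorem J_mul_J : J * J = 1 := by
  ext i j
  fin_cases i <;> fin_cases j <;> simp [J, Matrix.mul_apply, Matrix.diagonal]

/-- A matrix with `gᴴ J g = J` is invertible, with inverse `J gᴴ J`. -/
theorem mul_JconjJ {g : Matrix (Fin 3) (Fin 3) ℂ} (h : gᴴ * J * g = J) : (J * gᴴ * J) * g = 1 := by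
  calc (J * gᴴ * J) * g = J * (gᴴ * J * g) := by simp only [Matrix.mul_assoc]
    _ = 1 := by rw [h, J_mul_J]

/-- Build an element of `U(2,1)` from a matrix satisfying the defining relation. -/
def mkU21 (g : Matrix (Fin 3) (Fin 3) ℂ) (h : gᴴ * J * g = J) : U21 :=
  ⟨⟨g, J * gᴴ * J, mul_eq_one_comm.mp (mul_JconjJ h), mul_JconjJ h⟩, h⟩

/-- The matrix of `mkU21 g h` is `g`. -/
@[simp] theorem mat_mkU21 (g : Matrix (Fin 3) (Fin 3) ℂ) (h : gᴴ * J * g = J) : mat (mkU21 g h) = g := rfl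

/-! ### `act` is a group action -/

/-- `mat` is multiplicative. -/
theorem mat_mul (g h : U21) : mat (g * h) = mat g * mat h := rfl

/-- `mat 1 = 1`. -/
theorem mat_one : mat (1 : U21) = 1 := rfl

/-- `(gh)·(z,1) = g·(h·(z,1))`. -/
theorem W3_mul (g h : U21) (z : Ball) : W3 (g * h) z = mat g *ᵥ W3 h z := by
  unfold W3; rw [mat_mul, Matrix.mulVec_mulVec]

/-- `1·(z,1) = (z,1)`. -/
theorem W3_one (z : Ball) : W3 1 z = lift z := by
  unfold W3; rw [mat_one, Matrix.one_mulVec]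

/-- `proj` only depends on the vector. -/
theorem proj_congr {w w' : Fin 3 → ℂ} (h : w = w') (hw : Q w < 0) (hw' : Q w' < 0) :
    proj w hw = proj w' hw' := by subst h; rfl

/-- `proj` is invariant under nonzero rescaling. -/
theorem proj_smul (w : Fin 3 → ℂ) (hw : Q w < 0) (μ : ℂ) (hμ : μ ≠ 0) (hw' : Q (μ • w) < 0) :
    proj (μ • w) hw' = proj w hw := by
  apply Subtype.ext
  ext i
  fin_cases i <;> simp [proj, mul_div_mul_left _ _ hμ]

/-- The lift of `proj w` is `w / w₂`. -/
theorem lift_proj (w : Fin 3 → ℂ) (hw : Q w < 0) : lift (proj w hw) = (w 2)⁻¹ • w := by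
  have h2 := ne_zero_of_Q_neg hw
  ext i
  fin_cases i <;> simp [lift, proj, div_eq_inv_mul, h2]

/-- `g · lift (h z) = (h·(z,1))₂⁻¹ · (gh)·(z,1)`. -/
theorem W3_act (g h : U21) (z : Ball) : W3 g (act h z) = (W3 h z 2)⁻¹ • W3 (g * h) z := by
  change mat g *ᵥ lift (proj (W3 h z) (Q_W3 h z)) = _
  rw [lift_proj, Matrix.mulVec_smul, W3_mul]

/-- `act` is compatible with multiplication: `g (h z) = (gh) z`. -/
theorem act_mul (g h : U21) (z : Ball) : act g (act h z) = act (g * h) z := by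
  have hQ : Q ((W3 h z 2)⁻¹ • W3 (g * h) z) < 0 := by rw [← W3_act]; exact Q_W3 g (act h z)
  calc act g (act h z) = proj (W3 g (act h z)) (Q_W3 g (act h z)) := rfl
    _ = proj ((W3 h z 2)⁻¹ • W3 (g * h) z) hQ := proj_congr (W3_act g h z) _ _
    _ = proj (W3 (g * h) z) (Q_W3 (g * h) z) :=
        proj_smul _ _ _ (inv_ne_zero (W3_2_ne_zero h z)) _
    _ = act (g * h) z := rfl

/-- The identity acts trivially. -/
theorem act_one (z : Ball) : act 1 z = z := by
  have hQ : Q (lift z) < 0 := Q_lift z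
  calc act 1 z = proj (W3 1 z) (Q_W3 1 z) := rfl
    _ = proj (lift z) hQ := proj_congr (W3_one z) _ _
    _ = z := by
        apply Subtype.ext
        ext i
        fin_cases i <;> simp [proj, lift]

/-- `U(2,1)` acts on the ball. -/
instance : MulAction U21 Ball where
  smul := act
  one_smul := act_one
  mul_smul g h z := (act_mul g h z).symm

/-- `g • z = act g z`. -/
theorem smul_def (g : U21) (z : Ball) : g • z = act g z := rfl

/-- `g⁻¹ (g z) = z`. -/
theorem act_inv_act (g : U21) (z : Ball) : act g⁻¹ (act g z) = z := by
  rw [← smul_def, ← smul_def, inv_smul_smul]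

/-! ### The chain rule for the Jacobian -/

/-- **Chain rule**: `J_{gh}(z) = J_g(hz) · J_h(z)`, an algebraic identity of the fractional-linear
formula. -/
theorem Jac_mul (g h : U21) (z : Ball) : Jac (g * h) z = Jac g (act h z) * Jac h z := by
  have hw : W3 h z 2 ≠ 0 := W3_2_ne_zero h z
  have hW : (mat g *ᵥ W3 h z) 2 ≠ 0 := by rw [← W3_mul]; exact W3_2_ne_zero (g * h) z
  unfold Jac
  rw [W3_act, W3_mul, mat_mul]
  generalize W3 h z = w at hw hW ⊢
  ext i j
  fin_cases i <;> fin_cases j <;>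
    simp [Matrix.mul_apply, Matrix.mulVec, dotProduct, Fin.sum_univ_two, Fin.sum_univ_three] <;>
    field_simp <;> ring

/-- The Jacobian of the identity is the identity matrix. -/
theorem Jac_one (z : Ball) : Jac 1 z = 1 := by
  unfold Jac
  rw [W3_one, mat_one]
  ext i j
  fin_cases i <;> fin_cases j <;> simp [lift, Matrix.one_apply]

/-- `J_{g⁻¹}(gz) · J_g(z) = 1`. -/
theorem Jac_inv_mul (g : U21) (z : Ball) : Jac g⁻¹ (act g z) * Jac g z = 1 := by
  rw [← Jac_mul, inv_mul_cancel, Jac_one]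

/-- Every Jacobian `J_g(z)` is invertible. -/
theorem isUnit_Jac (g : U21) (z : Ball) : IsUnit (Jac g z) :=
  IsUnit.of_mul_eq_one_right _ (Jac_inv_mul g z)

/-- `det J_g(z) ≠ 0`. -/
theorem det_Jac_ne_zero (g : U21) (z : Ball) : (Jac g z).det ≠ 0 :=
  (Matrix.isUnit_iff_isUnit_det _).mp (isUnit_Jac g z) |>.ne_zero

/-! ### The centre, boosts (transitivity) and the isotropy at the centre -/

/-- The centre `0 ∈ 𝔹²`. -/
def center : Ball := ⟨0, by simp [nsq]⟩

/-- The coordinates of the centre are `0`. -/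
theorem center_val : (center : Ball).1 = 0 := rfl

/-- `lift 0 = (0, 0, 1)`. -/
theorem lift_center : lift center = ![0, 0, 1] := by
  ext i; fin_cases i <;> simp [lift, center]

/-- `s(a) = √(1 − |a|²) ∈ (0, 1]`. -/
def sOf (a : Ball) : ℝ := Real.sqrt (1 - nsq a.1)

/-- `s(a) > 0`. -/
theorem sOf_pos (a : Ball) : 0 < sOf a := Real.sqrt_pos.mpr (by linarith [a.2])

/-- `s(a)² = 1 − |a|²`. -/
theorem sOf_sq (a : Ball) : sOf a ^ 2 = 1 - nsq a.1 := Real.sq_sqrt (by linarith [a.2])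

/-- `1 + s(a) ≠ 0` in `ℂ`. -/
theorem one_add_sOf_ne_zero (a : Ball) : (1 : ℂ) + (sOf a : ℂ) ≠ 0 := by
  have := sOf_pos a
  exact_mod_cast (by linarith : (1 : ℝ) + sOf a ≠ 0)

/-- `s(a) ≠ 0` in `ℂ`. -/
theorem sOf_ne_zero (a : Ball) : (sOf a : ℂ) ≠ 0 := by
  exact_mod_cast (sOf_pos a).ne'

/-- The relation `|a₀|² + |a₁|² = 1 − s²` in `ℂ`. -/
theorem conj_mul_add_conj_mul (a : Ball) :
    conj (a.1 0) * a.1 0 + conj (a.1 1) * a.1 1 = 1 - (sOf a : ℂ) ^ 2 := by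
  rw [Complex.conj_mul', Complex.conj_mul']
  have h := sOf_sq a
  have : ((sOf a ^ 2 : ℝ) : ℂ) = ((1 - nsq a.1 : ℝ) : ℂ) := by rw [h]
  simp only [nsq] at this
  push_cast at this
  linear_combination this

/-- The polynomial part `P_a = s(1+s) · T_a` of the boost `T_a ∈ U(2,1)` moving `0` to `a`
(the Lorentz boost `[[I + (γ−1)/|a|² a aᴴ, γ a], [γ aᴴ, γ]]`, `γ = 1/s`, scaled by `s(1+s)`). -/
def boostP (a : Ball) : Matrix (Fin 3) (Fin 3) ℂ :=
  !![(sOf a : ℂ) * (1 + (sOf a : ℂ)) + a.1 0 * conj (a.1 0), a.1 0 * conj (a.1 1),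
        (1 + (sOf a : ℂ)) * a.1 0;
     a.1 1 * conj (a.1 0), (sOf a : ℂ) * (1 + (sOf a : ℂ)) + a.1 1 * conj (a.1 1),
        (1 + (sOf a : ℂ)) * a.1 1;
     (1 + (sOf a : ℂ)) * conj (a.1 0), (1 + (sOf a : ℂ)) * conj (a.1 1), 1 + (sOf a : ℂ)]

/-- `P_aᴴ J P_a = (s(1+s))² J`. -/
theorem boostP_rel (a : Ball) :
    (boostP a)ᴴ * J * boostP a = ((sOf a : ℂ) * (1 + (sOf a : ℂ))) ^ 2 • J := by
  have R1 := conj_mul_add_conj_mul a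
  ext i j
  fin_cases i <;> fin_cases j <;>
    simp [boostP, J, Matrix.mul_apply, Fin.sum_univ_three, Matrix.conjTranspose_apply,
      Matrix.diagonal]
  · linear_combination (a.1 0 * conj (a.1 0)) * R1
  · linear_combination (a.1 0 * conj (a.1 1)) * R1
  · linear_combination ((1 + (sOf a : ℂ)) * a.1 0) * R1
  · linear_combination (a.1 1 * conj (a.1 0)) * R1
  · linear_combination (a.1 1 * conj (a.1 1)) * R1
  · linear_combination ((1 + (sOf a : ℂ)) * a.1 1) * R1
  · linear_combination ((1 + (sOf a : ℂ)) * conj (a.1 0)) * R1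
  · linear_combination ((1 + (sOf a : ℂ)) * conj (a.1 1)) * R1
  · linear_combination ((1 + (sOf a : ℂ)) ^ 2) * R1

/-- The scaling factor `k = (s(1+s))⁻¹`. -/
def kOf (a : Ball) : ℝ := (sOf a * (1 + sOf a))⁻¹

/-- `k ≠ 0` in `ℂ`. -/
theorem kOf_ne_zero (a : Ball) : (kOf a : ℂ) ≠ 0 := by
  have h1 := sOf_pos a
  have : kOf a ≠ 0 := inv_ne_zero (by positivity)
  exact_mod_cast this

/-- The boost matrix `T_a = k · P_a`. -/
def boostMat (a : Ball) : Matrix (Fin 3) (Fin 3) ℂ := ((kOf a : ℝ) : ℂ) • boostP a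

/-- `T_aᴴ J T_a = J`. -/
theorem boostMat_rel (a : Ball) : (boostMat a)ᴴ * J * boostMat a = J := by
  unfold boostMat
  rw [Matrix.conjTranspose_smul, Matrix.smul_mul, Matrix.smul_mul, Matrix.mul_smul, boostP_rel,
    smul_smul, smul_smul]
  have hs := sOf_ne_zero a
  have hs1 := one_add_sOf_ne_zero a
  have hk : star ((kOf a : ℝ) : ℂ) * ((kOf a : ℝ) : ℂ) * ((sOf a : ℂ) * (1 + (sOf a : ℂ))) ^ 2 = 1 := by
    rw [Complex.star_def, Complex.conj_ofReal]
    unfold kOf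
    push_cast
    field_simp
  rw [hk, one_smul]

/-- The boost `T_a ∈ U(2,1)`. -/
def boost (a : Ball) : U21 := mkU21 (boostMat a) (boostMat_rel a)

/-- `T_a · 0 = a`: `U(2,1)` is transitive on the ball. -/
theorem act_boost_center (a : Ball) : act (boost a) center = a := by
  have hk := kOf_ne_zero a
  have hs1 := one_add_sOf_ne_zero a
  apply Subtype.ext
  ext i
  fin_cases i <;>
    simp [act, proj, W3, boost, boostMat, boostP, lift_center, Matrix.mulVec, dotProduct,
      Fin.sum_univ_three] <;>
    field_simp

/-- **Transitivity**: any two points of the ball are related by an element of `U(2,1)`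
(`γ = T_w T_z⁻¹`). -/
theorem exists_act_eq (z w : Ball) : ∃ g : U21, act g z = w := by
  set h := boost z with hh
  set g := boost w with hg
  have hz : act h⁻¹ z = center := by
    conv_lhs => rw [← act_boost_center z]
    exact act_inv_act h center
  exact ⟨g * h⁻¹, by rw [← act_mul, hz, act_boost_center]⟩

/-- Every `w` is reached from every `z`: the action is pretransitive. -/
instance : MulAction.IsPretransitive U21 Ball :=
  ⟨fun z w => by obtain ⟨g, hg⟩ := exists_act_eq z w; exact ⟨g, hg⟩⟩

/-- The orbit of any point is the whole ball. -/
theorem orbit_eq_univ (z : Ball) : MulAction.orbit U21 z = Set.univ :=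
  MulAction.orbit_eq_univ U21 z

/-- The swap `(z₀, z₁) ↦ (z₁, z₀)` as an element of `U(2,1)`. -/
def swapMat : Matrix (Fin 3) (Fin 3) ℂ := !![0, 1, 0; 1, 0, 0; 0, 0, 1]

/-- The swap matrix lies in `U(2,1)`. -/
theorem swapMat_rel : swapMatᴴ * J * swapMat = J := by
  ext i j
  fin_cases i <;> fin_cases j <;>
    simp [swapMat, J, Matrix.mul_apply, Fin.sum_univ_three, Matrix.conjTranspose_apply,
      Matrix.diagonal]

/-- The swap as an element of `U(2,1)`. -/
def swapU : U21 := mkU21 swapMat swapMat_rel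

/-- The phase `(z₀, z₁) ↦ (z₀, i z₁)` as an element of `U(2,1)`. -/
def phaseMat : Matrix (Fin 3) (Fin 3) ℂ := !![1, 0, 0; 0, Complex.I, 0; 0, 0, 1]

/-- The phase matrix lies in `U(2,1)`. -/
theorem phaseMat_rel : phaseMatᴴ * J * phaseMat = J := by
  ext i j
  fin_cases i <;> fin_cases j <;>
    simp [phaseMat, J, Matrix.mul_apply, Fin.sum_univ_three, Matrix.conjTranspose_apply,
      Matrix.diagonal]

/-- The phase as an element of `U(2,1)`. -/
def phaseU : U21 := mkU21 phaseMat phaseMat_rel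

end BallCore

end Summit.Ventures.HodgeRepro

end
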